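import Summits.QuantumFields.YangMills.Theorems.BalabanLadderIRTwistedSlabSliceDecomposition
import Summits.QuantumFields.YangMills.Theorems.BalabanLadderIRTwistedSlabExpChart
import HarnessLib

/-!
# The orbit × fluctuation map `(φ, y) ↦ e^{φ} • (e^{y} · L)` in the exponential chart: `C^∞`, and its differential at `(0, 0)` is
# `(φ, y) ↦ (y_μ(x) − ∇⁺_μ φ(x)) · L(x, μ)` — the linearised gauge action plus the fluctuation (calculus core of the slice chart M1b)

HELPER toward stub **T1** `TwistedSlabAnchor` (LINE `twisted-slab-continuity`, crux `IRcof` stmt-QuantumFields-26930, census row 43;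
LEAD prover ym-ir-line-tsc-p1 g3; `--supports` the crux, `--as helper`).  Sequel of K11 (`…SliceDecomposition`: at the twist eater `(φ, y) ↦ grad φ + y` is a
linear isomorphism `tracelessFields × ker div ≃ (Fin 4 → tracelessFields)`) and K4 (`…ExpChart`: real analyticity of `exp` in the Frobenius-normed algebra).
* §1 `orbitFluct L (φ, y) = (μ, x) ↦ e^{φ(x)} · e^{y_μ(x)} · L(x,μ) · e^{−φ(x+e_μ)}` — the gauge transformation `e^{φ}` (for skew `φ`, `e^{−φ} = (e^{φ})⁻¹`)
  of the left-perturbed configuration `e^{y} · L`, in the ambient algebra `M_N(ℂ)^E`; ★ `contDiff_orbitFluct` (`C^∞`); `orbitFluct_zero` (`= L`).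
* §2 ★ `hasDerivAt_orbitFluct_line`: along `t ↦ t • (φ, y)` each link has derivative `(φ(x) + y_μ(x)) · L(x,μ) − L(x,μ) · φ(x+e_μ)` at `t = 0` (three
  `hasDerivAt_exp_smul_const` factors); ★★ `fderiv_orbitFluct_zero_apply`: the differential at `0` applied to `(φ, y)` is that field (line derivative =
  Fréchet derivative for a `C^∞` map); ★★ `fderiv_orbitFluct_zero_apply_of_unitary`: for a UNITARY background `= (μ, x) ↦ (y_μ(x) − ∇⁺_μ φ(x)) · L(x,μ)`
  (`∇⁺` of `…CovariantCalculus`), i.e. right translation by `L` of `gaugeSliceEquiv (−φ, y)` — so with K11 the differential restricted to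
  `tracelessFields × ker div` is INJECTIVE (`fderiv_orbitFluct_zero_injective_on_slice`): the inverse-function-theorem input of the tubular coordinates.
NOT here (honest scope): the log chart on `SU(N)^E` turning this into a map between spaces of EQUAL dimension, the inverse function theorem, the Haar
densities and the `hchart` identity (the rest of M1b); M3; M4; T1-box 0∕1, T1 proper 0∕1.

HONEST FRAMING: calculus on one box; nothing here bears on `IRcof`, `IR`, or the Yang–Mills mass gap (Clay: NOT proved); R4 = `BalabanLadder.UV` only.
References: M. García Pérez, A. González-Arroyo, M. Okawa, JHEP 10 (2017) 150 §2.3, §2.5 (background gauge fixing around the twist eater); I. Montvay,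
G. Münster, *Quantum Fields on a Lattice* §3.2.5.
-/

set_option autoImplicit false

noncomputable section

open scoped Matrix Matrix.Norms.Frobenius Topology
open Finset NormedSpace
open Literature.MathematicalPhysics.QuantumFieldTheory Literature.MathematicalPhysics.QuantumLattice
open Literature.Analysis.OperatorTheory

namespace Summit.QuantumFields.YangMills.Cruxes.IRcof.TwistedSlab

variable {N : ℕ} {n₀ n₁ n₂ n₃ : ℕ}

/-! ## §1 The orbit × fluctuation map and its smoothness -/

section Def

variable (L : FinTorusSite n₀ n₁ n₂ n₃ × Fin 4 → Matrix (Fin N) (Fin N) ℂ)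

/-- **The orbit × fluctuation map** in the ambient algebra: `orbitFluct L (φ, y) (μ, x) = e^{φ(x)} e^{y_μ(x)} L(x,μ) e^{−φ(x+e_μ)}` — the gauge transformation
generated by `φ` applied to the left-perturbed configuration `e^{y}·L`. [cite: GarciaperezGonzalezarroyoOkawa2017, §2.3, §2.5] -/
def orbitFluct (p : (FinTorusSite n₀ n₁ n₂ n₃ → Matrix (Fin N) (Fin N) ℂ) × (Fin 4 → FinTorusSite n₀ n₁ n₂ n₃ → Matrix (Fin N) (Fin N) ℂ)) :
    Fin 4 → FinTorusSite n₀ n₁ n₂ n₃ → Matrix (Fin N) (Fin N) ℂ :=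
  fun μ x => exp (p.1 x) * exp (p.2 μ x) * L (x, μ) * exp (-(p.1 (x.shift μ)))

/-- At `(0, 0)` the map returns the background. [folklore] -/
theorem orbitFluct_zero : orbitFluct L 0 = fun μ x => L (x, μ) := by
  funext μ x; simp [orbitFluct]

/-- The three evaluations `p ↦ p.1 x`, `p ↦ p.2 μ x`, `p ↦ p.1 (x + e_μ)` are continuous linear, hence smooth; their exponentials are smooth. [folklore] -/
theorem contDiff_exp_fst_eval (x : FinTorusSite n₀ n₁ n₂ n₃) :
    ContDiff ℝ ⊤ (fun p : (FinTorusSite n₀ n₁ n₂ n₃ → Matrix (Fin N) (Fin N) ℂ) × (Fin 4 → FinTorusSite n₀ n₁ n₂ n₃ → Matrix (Fin N) (Fin N) ℂ) =>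
      exp (p.1 x)) := by
  have h : AnalyticOnNhd ℝ (fun Y : Matrix (Fin N) (Fin N) ℂ => exp Y) Set.univ := fun X _ => NormedSpace.exp_analytic X
  exact h.contDiff.comp ((contDiff_apply ℝ (Matrix (Fin N) (Fin N) ℂ) x).comp contDiff_fst)

/-- Smoothness of `p ↦ e^{−p.1 x}`. [folklore] -/
theorem contDiff_exp_neg_fst_eval (x : FinTorusSite n₀ n₁ n₂ n₃) :
    ContDiff ℝ ⊤ (fun p : (FinTorusSite n₀ n₁ n₂ n₃ → Matrix (Fin N) (Fin N) ℂ) × (Fin 4 → FinTorusSite n₀ n₁ n₂ n₃ → Matrix (Fin N) (Fin N) ℂ) =>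
      exp (-(p.1 x))) := by
  have h : AnalyticOnNhd ℝ (fun Y : Matrix (Fin N) (Fin N) ℂ => exp Y) Set.univ := fun X _ => NormedSpace.exp_analytic X
  exact h.contDiff.comp ((contDiff_apply ℝ (Matrix (Fin N) (Fin N) ℂ) x).comp contDiff_fst).neg

/-- Smoothness of `p ↦ e^{p.2 μ x}`. [folklore] -/
theorem contDiff_exp_snd_eval (μ : Fin 4) (x : FinTorusSite n₀ n₁ n₂ n₃) :
    ContDiff ℝ ⊤ (fun p : (FinTorusSite n₀ n₁ n₂ n₃ → Matrix (Fin N) (Fin N) ℂ) × (Fin 4 → FinTorusSite n₀ n₁ n₂ n₃ → Matrix (Fin N) (Fin N) ℂ) =>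
      exp (p.2 μ x)) := by
  have h : AnalyticOnNhd ℝ (fun Y : Matrix (Fin N) (Fin N) ℂ => exp Y) Set.univ := fun X _ => NormedSpace.exp_analytic X
  exact h.contDiff.comp ((contDiff_apply_apply ℝ (Matrix (Fin N) (Fin N) ℂ) μ x).comp contDiff_snd)

/-- ★ **The orbit × fluctuation map is `C^∞`.** [folklore] -/
theorem contDiff_orbitFluct : ContDiff ℝ ⊤ (orbitFluct L) := by
  refine contDiff_pi.2 fun μ => contDiff_pi.2 fun x => ?_
  exact ContDiff.mul (ContDiff.mul (ContDiff.mul (contDiff_exp_fst_eval x) (contDiff_exp_snd_eval μ x)) contDiff_const) (contDiff_exp_neg_fst_eval _)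

/-- The orbit × fluctuation map is differentiable. [folklore] -/
theorem differentiable_orbitFluct : Differentiable ℝ (orbitFluct L) := (contDiff_orbitFluct L).differentiable WithTop.top_ne_zero

end Def

/-! ## §2 The differential at `(0, 0)` -/

section Deriv

variable (L : FinTorusSite n₀ n₁ n₂ n₃ × Fin 4 → Matrix (Fin N) (Fin N) ℂ)
  (φ : FinTorusSite n₀ n₁ n₂ n₃ → Matrix (Fin N) (Fin N) ℂ) (y : Fin 4 → FinTorusSite n₀ n₁ n₂ n₃ → Matrix (Fin N) (Fin N) ℂ)

/-- ★ **Link-by-link line derivative at `0`**: `d/dt|₀ e^{tφ(x)} e^{t y_μ(x)} L e^{−tφ(x+e_μ)} = (φ(x) + y_μ(x))·L − L·φ(x+e_μ)`. [folklore] -/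
theorem hasDerivAt_orbitFluct_line (μ : Fin 4) (x : FinTorusSite n₀ n₁ n₂ n₃) :
    HasDerivAt (fun t : ℝ => orbitFluct L (t • (φ, y)) μ x) ((φ x + y μ x) * L (x, μ) - L (x, μ) * φ (x.shift μ)) 0 := by
  have h1 := hasDerivAt_exp_smul_const' (𝕂 := ℝ) (φ x) (0 : ℝ)
  have h2 := hasDerivAt_exp_smul_const' (𝕂 := ℝ) (y μ x) (0 : ℝ)
  have h3 := hasDerivAt_exp_smul_const (𝕂 := ℝ) (-(φ (x.shift μ))) (0 : ℝ)
  simp only [zero_smul, exp_zero, Matrix.mul_one, Matrix.one_mul] at h1 h2 h3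
  have h12 := h1.mul h2
  have h12L : HasDerivAt (fun t : ℝ => exp (t • φ x) * exp (t • y μ x) * L (x, μ)) ((φ x + y μ x) * L (x, μ)) 0 := by
    have h := h12.mul_const (L (x, μ))
    refine h.congr_deriv ?_
    simp only [zero_smul, exp_zero, Matrix.mul_one, Matrix.one_mul, Matrix.add_mul]
  have hall := h12L.mul h3
  have e : (fun t : ℝ => orbitFluct L (t • (φ, y)) μ x) =
      fun t : ℝ => exp (t • φ x) * exp (t • y μ x) * L (x, μ) * exp (t • (-(φ (x.shift μ)))) := by
    funext t
    simp only [orbitFluct, Prod.smul_fst, Prod.smul_snd, Pi.smul_apply, smul_neg]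
  rw [e]
  refine hall.congr_deriv ?_
  simp only [zero_smul, exp_zero, Matrix.mul_one, Matrix.one_mul, Matrix.mul_neg]
  abel

/-- The line derivative of the whole configuration. [folklore] -/
theorem hasDerivAt_orbitFluct_line_pi :
    HasDerivAt (fun t : ℝ => orbitFluct L (t • (φ, y))) (fun μ x => (φ x + y μ x) * L (x, μ) - L (x, μ) * φ (x.shift μ)) 0 :=
  hasDerivAt_pi.2 fun μ => hasDerivAt_pi.2 fun x => hasDerivAt_orbitFluct_line L φ y μ x

/-- ★★ **THE DIFFERENTIAL OF THE ORBIT × FLUCTUATION MAP AT THE BACKGROUND**: `D(orbitFluct L)(0)(φ, y) = (μ, x) ↦ (φ(x) + y_μ(x))·L(x,μ) − L(x,μ)·φ(x+e_μ)`.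
[cite: GarciaperezGonzalezarroyoOkawa2017, §2.3, §2.5] -/
theorem fderiv_orbitFluct_zero_apply :
    fderiv ℝ (orbitFluct L) 0 (φ, y) = fun μ x => (φ x + y μ x) * L (x, μ) - L (x, μ) * φ (x.shift μ) := by
  have hline : HasDerivAt (fun t : ℝ => orbitFluct L ((0 : _) + t • (φ, y))) (fderiv ℝ (orbitFluct L) 0 (φ, y)) 0 := by
    have h := ((differentiable_orbitFluct L) 0).hasFDerivAt.hasLineDerivAt (φ, y)
    exact h
  have hline' : HasDerivAt (fun t : ℝ => orbitFluct L ((0 : _) + t • (φ, y)))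
      (fun μ x => (φ x + y μ x) * L (x, μ) - L (x, μ) * φ (x.shift μ)) 0 := by
    have e : (fun t : ℝ => orbitFluct L ((0 : _) + t • (φ, y))) = fun t : ℝ => orbitFluct L (t • (φ, y)) := by
      funext t; rw [zero_add]
    rw [e]; exact hasDerivAt_orbitFluct_line_pi L φ y
  exact hline.unique hline'

/-- ★★ **At a UNITARY background the differential is `(φ, y) ↦ (y_μ − ∇⁺_μ φ)·L`** — the fluctuation minus the linearised gauge action, right-translated
by the background: with K11's `gaugeSliceEquiv` this is injective on `tracelessFields × ker div` (next theorem). [cite: GarciaperezGonzalezarroyoOkawa2017, §2.5] -/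
theorem fderiv_orbitFluct_zero_apply_of_unitary (hL : ∀ e, L e ∈ Matrix.unitaryGroup (Fin N) ℂ) :
    fderiv ℝ (orbitFluct L) 0 (φ, y) = fun μ x => (y μ x - covDeriv L μ φ x) * L (x, μ) := by
  rw [fderiv_orbitFluct_zero_apply]
  funext μ x
  have h : (L (x, μ))ᴴ * L (x, μ) = 1 := (hL (x, μ)).1
  rw [covDeriv_apply, Matrix.sub_mul, Matrix.sub_mul, Matrix.mul_assoc (L (x, μ) * φ (x.shift μ)), h, Matrix.mul_one, Matrix.add_mul]
  abel

variable {L}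

/-- ★ **Injectivity of the differential on gauge modes × Coulomb slice** at the twist-eating ladder (the inverse-function-theorem input): if
`(y − ∇⁺φ)·L = 0` with `φ` traceless and `y ∈ ker div` traceless, then `φ = 0` and `y = 0` (K11 `gaugeSliceEquiv`).
[cite: GarciaperezGonzalezarroyoOkawa2017, §2.2, §2.5] -/
theorem fderiv_orbitFluct_zero_injective_on_slice [NeZero N] {m n₂' n₃' : ℕ} {A B : Matrix (Fin N) (Fin N) ℂ} {ω : ℂ}
    {Γ₂ Γ₃ : Matrix (Fin N) (Fin N) ℂ} (hAu : A ∈ Matrix.unitaryGroup (Fin N) ℂ) (hBu : B ∈ Matrix.unitaryGroup (Fin N) ℂ) (hω : IsPrimitiveRoot ω N)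
    (hAB : A * B = ω • (B * A)) (hNm : 2 ≤ N * (m + 1))
    (hU : ∀ e, ladderField (n₀ := m + 1) (n₁ := m + 1) (n₂ := n₂') (n₃ := n₃') ![A, B, Γ₂, Γ₃] e ∈ Matrix.unitaryGroup (Fin N) ℂ)
    (φ : tracelessFields N (m + 1) (m + 1) n₂' n₃') (y : LinearMap.ker (DiscreteWeitzenboeck.covDiv (tracelessDadj hU)))
    (h0 : fderiv ℝ (orbitFluct (ladderField ![A, B, Γ₂, Γ₃])) 0
      ((φ : FinTorusSite (m + 1) (m + 1) n₂' n₃' → Matrix (Fin N) (Fin N) ℂ),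
        fun μ => (((y : Fin 4 → tracelessFields N (m + 1) (m + 1) n₂' n₃') μ : tracelessFields N (m + 1) (m + 1) n₂' n₃') :
          FinTorusSite (m + 1) (m + 1) n₂' n₃' → Matrix (Fin N) (Fin N) ℂ)) = 0) :
    φ = 0 ∧ y = 0 := by
  rw [fderiv_orbitFluct_zero_apply_of_unitary _ _ _ hU] at h0
  -- cancel the unitary right factor: `y μ x − ∇⁺_μ φ x = 0`
  have hpt : ∀ μ x, (((y : Fin 4 → tracelessFields N (m + 1) (m + 1) n₂' n₃') μ : tracelessFields N (m + 1) (m + 1) n₂' n₃') :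
      FinTorusSite (m + 1) (m + 1) n₂' n₃' → Matrix (Fin N) (Fin N) ℂ) x -
      covDeriv (ladderField ![A, B, Γ₂, Γ₃]) μ (φ : FinTorusSite (m + 1) (m + 1) n₂' n₃' → Matrix (Fin N) (Fin N) ℂ) x = 0 := by
    intro μ x
    have h := congrFun (congrFun h0 μ) x
    have hL2 : ladderField ![A, B, Γ₂, Γ₃] (x, μ) * (ladderField (n₀ := m + 1) (n₁ := m + 1) (n₂ := n₂') (n₃ := n₃') ![A, B, Γ₂, Γ₃] (x, μ))ᴴ = 1 :=
      (hU (x, μ)).2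
    have h' := congrArg (fun M => M * (ladderField (n₀ := m + 1) (n₁ := m + 1) (n₂ := n₂') (n₃ := n₃') ![A, B, Γ₂, Γ₃] (x, μ))ᴴ) h
    simpa only [Pi.zero_apply, Matrix.zero_mul, Matrix.mul_assoc, hL2, Matrix.mul_one] using h'
  -- `gaugeSliceEquiv (−φ, y) = 0`
  have hE : gaugeSliceEquiv hAu hBu hω hAB hNm hU (-φ, y) = 0 := by
    funext μ
    apply Subtype.ext
    funext x
    rw [coe_gaugeSliceEquiv_apply]
    have h := hpt μ x
    simp only [Pi.zero_apply, ZeroMemClass.coe_zero, Pi.zero_apply, Submodule.coe_neg]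
    rw [show covDeriv (ladderField ![A, B, Γ₂, Γ₃]) μ (-(φ : FinTorusSite (m + 1) (m + 1) n₂' n₃' → Matrix (Fin N) (Fin N) ℂ)) x =
        -covDeriv (ladderField ![A, B, Γ₂, Γ₃]) μ (φ : FinTorusSite (m + 1) (m + 1) n₂' n₃' → Matrix (Fin N) (Fin N) ℂ) x by
      simp only [covDeriv, covShift, Pi.neg_apply, Matrix.mul_neg, Matrix.neg_mul]; abel]
    rw [← h]; abel
  have hpair : ((-φ, y) : tracelessFields N (m + 1) (m + 1) n₂' n₃' × LinearMap.ker (DiscreteWeitzenboeck.covDiv (tracelessDadj hU))) = 0 :=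
    (gaugeSliceEquiv hAu hBu hω hAB hNm hU).injective (by rw [hE, map_zero])
  rw [Prod.mk_eq_zero, neg_eq_zero] at hpair
  exact hpair

end Deriv

end Summit.QuantumFields.YangMills.Cruxes.IRcof.TwistedSlab

end
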